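import Summits.ValiantsHypothesis.ValiantsHypothesis.Theorems.ZeroOneTransfer.Negative.KillRows
import Literature.Barriers.ValiantsHypothesis.MonotoneGapPermanentLower
import Literature.Computability.AlgebraicComplexity.ArithCircuitProofs

/-!
# `PerDivisionHard` — support lemma: Jerrum–Snir by SUPPORT for the permanent, weighted circuits

Crux `stmt-ValiantsHypothesis-5065` (`Theses.DivisionGap.PerDivisionHard`, H1 of route
DivisionGap); filed by the standing disprover of the sibling crux `ZeroOneTransfer` (5066),
`Cruxes/ZeroOneTransfer/Disproof.lean` §(B2'), as the lower-bound half of the low-degree rung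
`PerLowDegreeRung.lean`.

* `two_pow_le_choose_middle` — `2^{m/3} ≤ C(m,k)` for `m/3 < k ≤ 2(m/3)` (central binomials).
* `card_support_mul_choose_le` — rectangle bound: `mon(a·b) ⊆ mon(per_m)` over `ℝ≥0` forces
  `|mon(a·b)| · C(m, deg a) ≤ m!` (JS's content bound `card_mul_card_mul_card_le` with `C = {0}`).
* `two_pow_le_prodCount_of_support_eq_perPoly` — every fan-in-two circuit over `ℝ≥0` (WEIGHTED
  sums allowed: the tree's `complexity` model) computing a polynomial with the support of `per_m`,
  `m ≥ 6`, has `≥ 2^{m/3}` product gates (balanced decomposition `exists_decomposition` + the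
  rectangle bound; weaker constant than JS's exact `n(2^{n-1}-1)` for plain circuits, but
  support-only and weighted).
* `rename_perPoly`, `two_pow_le_complexity_of_support_eq_perPoly` — the same on any index type.
[cite: JerrumSnir1982, §4.3 and Cor. 3.5]
-/

namespace Summit.ValiantsHypothesis.ValiantsHypothesis.Theorems.PerDivisionHard.Negative

open Literature.Computability.AlgebraicComplexity Literature.Barriers.ValiantsHypothesis
open Summit.ValiantsHypothesis.ValiantsHypothesis.Theorems.ZeroOneTransfer.Negative
open MvPolynomial Finset
open scoped NNReal

noncomputable section

/-! ### Jerrum–Snir for every polynomial with the support of `per` (weighted circuits) -/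

section PerSupportBound

variable {m : ℕ}

/-- `2^k ≤ C(2k, k)` (from `4^k ≤ 2k · C(2k,k)` and `2k ≤ 2^k`). [folklore] -/
theorem two_pow_le_centralBinom (k : ℕ) : 2 ^ k ≤ k.centralBinom := by
  rcases Nat.eq_zero_or_pos k with rfl | hk
  · simp
  have h4 := Nat.four_pow_le_two_mul_self_mul_centralBinom k hk
  have h2k : 2 * k ≤ 2 ^ k := by
    induction k with
    | zero => simp
    | succ j ih =>
      rcases Nat.eq_zero_or_pos j with rfl | hj
      · simp
      · have := ih hj (Nat.four_pow_le_two_mul_self_mul_centralBinom j hj); rw [pow_succ]; omega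
  have h4' : (4 : ℕ) ^ k = 2 ^ k * 2 ^ k := by
    rw [← mul_pow]; norm_num
  rw [h4'] at h4
  -- `2^k * 2^k ≤ 2k * C ≤ 2^k * C`
  have : 2 ^ k * 2 ^ k ≤ 2 ^ k * k.centralBinom :=
    h4.trans (Nat.mul_le_mul_right _ h2k)
  exact Nat.le_of_mul_le_mul_left this (by positivity)

/-- Middle binomial coefficients are exponential: for `m/3 < k ≤ 2(m/3)`,
`2^{m/3} ≤ C(m, k)`. [folklore] -/
theorem two_pow_le_choose_middle {m k : ℕ} (hk : m / 3 < k) (hk2 : k ≤ 2 * (m / 3)) :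
    2 ^ (m / 3) ≤ m.choose k := by
  -- `k' = min k (m - k) ≥ m/3` and `C(m,k) = C(m,k') ≥ C(2k',k') ≥ 2^{k'}`
  have hkm : k ≤ m := by omega
  by_cases hhalf : 2 * k ≤ m
  · calc 2 ^ (m / 3) ≤ 2 ^ k := Nat.pow_le_pow_right two_pos (by omega)
      _ ≤ k.centralBinom := two_pow_le_centralBinom k
      _ = (2 * k).choose k := Nat.centralBinom_eq_two_mul_choose k
      _ ≤ m.choose k := Nat.choose_le_choose k hhalf
  · rw [← Nat.choose_symm hkm]
    calc 2 ^ (m / 3) ≤ 2 ^ (m - k) := Nat.pow_le_pow_right two_pos (by omega)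
      _ ≤ (m - k).centralBinom := two_pow_le_centralBinom (m - k)
      _ = (2 * (m - k)).choose (m - k) := Nat.centralBinom_eq_two_mul_choose _
      _ ≤ m.choose (m - k) := Nat.choose_le_choose _ (by omega)

/-- **Rectangle bound for the permanent**: if `mon(a · b) ⊆ mon(per_m)` over `ℝ≥0` with
`a, b ≠ 0` and `k = deg a`, then `|mon(a·b)| · C(m,k) ≤ m!` and `k ≤ m` — all monomials of `a`
have degree `k`, those of `b` degree `m - k`, and Jerrum–Snir's content bound gives
`|mon a| · |mon b| ≤ k! (m-k)!`. [cite: JerrumSnir1982, §4.3 (p. 887–888)] -/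
theorem card_support_mul_choose_le {a b : MvPolynomial (Fin m × Fin m) ℝ≥0}
    (hab : (a * b).support ⊆ (perPoly (Fin m) ℝ≥0).support) (ha : a ≠ 0) (hb : b ≠ 0) :
    (a * b).support.card * m.choose a.totalDegree ≤ m.factorial ∧ a.totalDegree ≤ m := by
  classical
  obtain ⟨a₀, ha₀⟩ := exists_coeff_ne_zero ha
  obtain ⟨b₀, hb₀⟩ := exists_coeff_ne_zero hb
  have ha₀s : a₀ ∈ a.support := mem_support_iff.mpr ha₀
  have hb₀s : b₀ ∈ b.support := mem_support_iff.mpr hb₀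
  -- every pair of monomials glues to a permutation monomial
  have hpair : ∀ x ∈ a.support, ∀ y ∈ b.support, x + y ∈ (perPoly (Fin m) ℝ≥0).support :=
    fun x hx y hy => hab (by rw [JerrumSnir.support_mul_eq]; exact Finset.add_mem_add hx hy)
  have hdegxy : ∀ x ∈ a.support, ∀ y ∈ b.support, (x + y).degree = m := by
    intro x hx y hy
    obtain ⟨σ, hσ⟩ := (JerrumSnir.mem_support_perPoly ℝ≥0).1 (hpair x hx y hy)
    rw [← hσ]; exact JerrumSnir.degree_permMonomial σ
  -- all monomials of `a` have degree `deg a₀`, which is the total degree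
  have hdegx : ∀ x ∈ a.support, x.degree = a₀.degree := by
    intro x hx
    have h1 := hdegxy x hx b₀ hb₀s
    have h2 := hdegxy a₀ ha₀s b₀ hb₀s
    rw [map_add] at h1 h2
    omega
  have hsum : ∀ s : (Fin m × Fin m) →₀ ℕ, (s.sum fun _ e => e) = s.degree := fun s => by
    rw [Finsupp.degree_apply]; rfl
  have htot : a.totalDegree = a₀.degree := by
    apply le_antisymm
    · rw [MvPolynomial.totalDegree]
      refine Finset.sup_le fun x hx => ?_
      rw [hsum, hdegx x hx]
    · have := le_totalDegree ha₀s
      rwa [hsum] at this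
  -- JS content bound with `C = {0}`
  have h3 := JerrumSnir.card_mul_card_mul_card_le ℝ≥0 (A := a.support) (B := b.support)
    (C := ({0} : Finset (Fin m × Fin m →₀ ℕ))) ha₀s hb₀s ⟨0, Finset.mem_singleton_self 0⟩
    (fun x hx y hy c hc => by rw [Finset.mem_singleton.mp hc, add_zero]; exact hpair x hx y hy)
  obtain ⟨hcard, hdeg⟩ := h3
  rw [Finset.card_singleton, mul_one] at hcard
  have hm : (a₀ + b₀).degree = m := hdegxy a₀ ha₀s b₀ hb₀s
  have hb₀deg : b₀.degree = m - a₀.degree := by rw [map_add] at hm; omega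
  rw [hm, Nat.sub_self, Nat.factorial_zero, mul_one, hb₀deg] at hcard
  have hk : a₀.degree ≤ m := by rw [map_add] at hm; omega
  refine ⟨?_, htot ▸ hk⟩
  rw [htot]
  -- `|mon(ab)| ≤ |mon a| |mon b| ≤ k! (m-k)!` and `C(m,k) k! (m-k)! = m!`
  have hsub : (a * b).support.card ≤ a.support.card * b.support.card :=
    (Finset.card_le_card (support_mul a b)).trans (Finset.card_add_le)
  calc (a * b).support.card * m.choose a₀.degree
      ≤ (a₀.degree.factorial * (m - a₀.degree).factorial) * m.choose a₀.degree :=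
        Nat.mul_le_mul_right _ (hsub.trans hcard)
    _ = m.factorial := by
        rw [mul_comm, ← mul_assoc, Nat.choose_mul_factorial_mul_factorial hk]

/-- **Jerrum–Snir by support for the permanent (weighted fan-in-two circuits over `ℝ≥0`).**
Every fan-in-two circuit computing a polynomial with the SUPPORT of `per_m`, `m ≥ 6`, has at
least `2^{m/3}` product gates. [cite: JerrumSnir1982, §4.3 and Cor. 3.5] -/
theorem two_pow_le_prodCount_of_support_eq_perPoly (hm : 6 ≤ m)
    {p : MvPolynomial (Fin m × Fin m) ℝ≥0} (hp : p.support = (perPoly (Fin m) ℝ≥0).support)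
    {P : ArithCircuit ℝ≥0 (Fin m × Fin m)} (hP2 : P.IsFanInTwo) (hP : P.Computes p) :
    2 ^ (m / 3) ≤ prodCount P := by
  classical
  have heval : P.eval = p := hP
  have hhom : p.IsHomogeneous m := by
    intro d hd
    have hd' : d ∈ (perPoly (Fin m) ℝ≥0).support := hp ▸ mem_support_iff.mpr hd
    have := perPoly_isHomogeneous (n := Fin m) (k := ℝ≥0) (mem_support_iff.mp hd')
    rwa [Fintype.card_fin] at this
  have hm1 : 1 ≤ m / 3 := by omega
  have hmN : m / 3 < m := by omega
  obtain ⟨L, hLlen, hLsum, hLdeg⟩ :=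
    Literature.Barriers.ValiantsHypothesis.exists_decomposition hm1 hmN _ P le_rfl hP2
      (by rw [heval]; exact hhom)
  rw [heval] at hLsum
  -- each product covers at most `m!/2^{m/3}` monomials: `2^{m/3} |mon(ab)| ≤ m!`
  have hterm : ∀ ab ∈ L, 2 ^ (m / 3) * (ab.1 * ab.2).support.card ≤ m.factorial := by
    intro ab hab
    by_cases hb : ab.2 = 0
    · simp [hb]
    have hdeg := hLdeg ab hab
    have ha : ab.1 ≠ 0 := by
      intro ha
      rw [ha, totalDegree_zero] at hdeg
      omega
    have hsub : (ab.1 * ab.2).support ⊆ (perPoly (Fin m) ℝ≥0).support := by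
      obtain ⟨q, hq⟩ := exists_sum_eq_add_of_mem (fun ab : MvPolynomial _ ℝ≥0 × _ => ab.1 * ab.2)
        L ab hab
      rw [← hp]
      exact support_subset_of_eq_add (hLsum.trans hq)
    obtain ⟨hcard, -⟩ := card_support_mul_choose_le hsub ha hb
    have hch := two_pow_le_choose_middle hdeg.1 hdeg.2
    calc 2 ^ (m / 3) * (ab.1 * ab.2).support.card
        ≤ m.choose ab.1.totalDegree * (ab.1 * ab.2).support.card := Nat.mul_le_mul_right _ hch
      _ = (ab.1 * ab.2).support.card * m.choose ab.1.totalDegree := mul_comm _ _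
      _ ≤ m.factorial := hcard
  -- count: `2^{m/3} m! ≤ Σ 2^{m/3} |mon(a_i b_i)| ≤ |L| m!`
  have hcount : 2 ^ (m / 3) * m.factorial ≤ L.length * m.factorial := by
    have hsupp : (perPoly (Fin m) ℝ≥0).support.card ≤
        (L.map fun ab => (ab.1 * ab.2).support.card).sum := by
      rw [← hp, hLsum]
      clear hLsum hLlen hLdeg hterm
      induction L with
      | nil => simp
      | cons ab L ih =>
        simp only [List.map_cons, List.sum_cons]
        exact (Finset.card_le_card (support_add)).trans ((Finset.card_union_le _ _).trans
          (Nat.add_le_add_left ih _))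
    rw [JerrumSnir.card_support_perPoly] at hsupp
    calc 2 ^ (m / 3) * m.factorial
        ≤ 2 ^ (m / 3) * (L.map fun ab => (ab.1 * ab.2).support.card).sum :=
          Nat.mul_le_mul_left _ hsupp
      _ = (L.map fun ab => 2 ^ (m / 3) * (ab.1 * ab.2).support.card).sum := by
          rw [List.sum_map_mul_left]
      _ ≤ (L.map fun _ => m.factorial).sum := List.sum_le_sum (fun ab hab => hterm ab hab)
      _ = L.length * m.factorial := by rw [List.map_const', List.sum_replicate, smul_eq_mul]
  have hfac : 0 < m.factorial := Nat.factorial_pos m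
  exact (Nat.le_of_mul_le_mul_right hcount hfac).trans hLlen

/-- Reindexing a permutation monomial along an equivalence. [folklore] -/
theorem mapDomain_permMonomial {ι κ : Type*} [Fintype ι] [DecidableEq ι] [Fintype κ]
    [DecidableEq κ] (e : ι ≃ κ) (σ : Equiv.Perm ι) :
    Finsupp.mapDomain (Prod.map e e) (permMonomial σ) = permMonomial (Equiv.permCongr e σ) := by
  unfold permMonomial
  rw [Finsupp.mapDomain_finsetSum,
    ← Equiv.sum_comp e (fun j : κ => Finsupp.single ((Equiv.permCongr e σ) j, j) (1 : ℕ))]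
  refine Finset.sum_congr rfl fun i _ => ?_
  rw [Finsupp.mapDomain_single (f := Prod.map e e) (a := (σ i, i)) (b := (1 : ℕ))]
  simp [Equiv.permCongr_apply]

/-- Reindexing the permanent along an equivalence. [folklore] -/
theorem rename_perPoly {ι κ : Type*} [Fintype ι] [DecidableEq ι] [Fintype κ] [DecidableEq κ]
    (e : ι ≃ κ) : rename (Prod.map e e) (perPoly ι ℝ≥0) = perPoly κ ℝ≥0 := by
  rw [perPoly_eq_sum_monomial, perPoly_eq_sum_monomial, map_sum]
  rw [← Equiv.sum_comp (Equiv.permCongr e)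
    (fun τ : Equiv.Perm κ => (monomial (permMonomial τ) (1 : ℝ≥0) : MvPolynomial (κ × κ) ℝ≥0))]
  refine Finset.sum_congr rfl fun σ _ => ?_
  rw [rename_monomial, mapDomain_permMonomial]

/-- Hence `2^{m/3} ≤ L_{ℝ≥0}(p)` for every `p` with the support of the permanent on any index
type of size `m ≥ 6` (rename to `Fin m`; complexity is invariant under injective renaming).
[cite: JerrumSnir1982, §4.3 and Cor. 3.5] -/
theorem two_pow_le_complexity_of_support_eq_perPoly {ι : Type*} [Fintype ι] [DecidableEq ι]
    (hm : 6 ≤ Fintype.card ι) {p : MvPolynomial (ι × ι) ℝ≥0}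
    (hp : p.support = (perPoly ι ℝ≥0).support) :
    2 ^ (Fintype.card ι / 3) ≤ complexity p := by
  classical
  set m := Fintype.card ι
  let e : ι ≃ Fin m := Fintype.equivFin ι
  have hinj : Function.Injective (Prod.map e e) := e.injective.prodMap e.injective
  have hp' : (rename (Prod.map e e) p).support = (perPoly (Fin m) ℝ≥0).support := by
    rw [support_rename_of_injective hinj, hp, ← support_rename_of_injective hinj, rename_perPoly]
  obtain ⟨P, h2, hP, hsize⟩ :=
    ArithCircuit.exists_computes_size_eq_complexity (rename (Prod.map e e) p)
  calc 2 ^ (m / 3) ≤ prodCount P := two_pow_le_prodCount_of_support_eq_perPoly hm hp' h2 hP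
    _ ≤ P.size := prodCount_le_size P
    _ = complexity (rename (Prod.map e e) p) := hsize
    _ = complexity p := complexity_rename_of_injective_holds hinj p

end PerSupportBound

end

end Summit.ValiantsHypothesis.ValiantsHypothesis.Theorems.PerDivisionHard.Negative
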